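import Literature.Probability.Moments.MGFConvergenceMoments
import Literature.Probability.Moments.GaussianMomentMethod
import HarnessLib

/-!
# Curtiss' continuity theorem: convergence of moment generating functions near `0` ⟹ weak convergence

Topic `Literature/Probability/Moments`; namespace `Literature.Probability.Moments`. THEOREMS ONLY (no definition, no
named fact, no instance, no notation). This file JOINS two results already in the tree:

* `tendsto_integral_prod_pow_of_tendsto_mgf` (`MGFConvergenceMoments.lean`, the moment half of Curtiss' theorem,
  multivariate): if the moment generating functions `∫ e^{s·x} dν_k` converge on an open cube around `0`, every mixed
  moment converges to SOME finite limit;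
* `tendsto_of_tendsto_integral_pow` / `tendsto_gaussianReal_of_tendsto_integral_pow` (`GaussianMomentMethod.lean`, the
  method of moments via Mathlib's Lévy convergence theorem `ProbabilityMeasure.tendsto_iff_tendsto_charFun`): if all
  moments of probability measures `μ_n` converge to those of a probability measure `ν` with all exponential moments,
  then `μ_n ⟶ ν` weakly;

into the classical continuity theorem for moment generating functions (J. H. Curtiss, *A note on the theory of moment
generating functions*, Ann. Math. Statist. **13** (1942) 430–433, Theorem 3 — there with the weaker hypothesis that the
limit mgf is finite on `|t| < α`; here the limit is asked to have all exponential moments, which covers the Gaussian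
and every limit law met in the lane):

* `tendsto_integral_pow_of_tendsto_mgf` — ONE VARIABLE, LIMIT IDENTIFIED: if `∫ e^{sx} dμ_n → ∫ e^{sx} dν` for all
  `|s| < δ` (all these integrals finite), then `∫ x^k dμ_n → ∫ x^k dν` for every `k` (the multivariate theorem applied on
  `Fin 1 → ℝ` to the sequence `μ_0, ν, μ_1, ν, …` INTERLEAVED with the constant sequence `ν`: its moments converge, and
  the odd-indexed subsequence pins the limit);
* ★★★ `tendsto_of_tendsto_mgf` — **Curtiss' continuity theorem**: probability measures on `ℝ` whose mgfs converge on a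
  neighbourhood of `0` to the mgf of a probability measure `ν` having all exponential moments converge weakly to `ν`
  (`ProbabilityMeasure ℝ`, Mathlib's topology of weak convergence); `tendsto_integral_of_tendsto_mgf` (bounded continuous
  test functions); `tendsto_measure_Iic_of_tendsto` / `tendsto_measureReal_Iic_of_tendsto` (portmanteau: distribution
  functions converge at every point when the limit has no atoms);
* ★★★ `tendsto_gaussianReal_of_tendsto_mgf` — the Gaussian case `∫ e^{sx} dμ_n → e^{ms + vs²/2}` (`|s| < δ`) ⟹
  `μ_n ⟶ N(m, v)`, and `tendsto_measureReal_Iic_gaussianReal_of_tendsto_mgf` (`'`): `μ_n(−∞, x] → N(m,v)(−∞, x] =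
  ∫_{(−∞, x]} φ_{m,v}` for every real `x` (`v ≠ 0`) — the form in which a central limit theorem is read off a
  computation of moment generating functions.

## Mathlib / tree
USES `Literature.Probability.Moments.tendsto_integral_prod_pow_of_tendsto_mgf`, `….exists_const_pow_approx`,
`….tendsto_of_tendsto_integral_pow`, Mathlib `MeasureTheory.integral_map`, `integrable_map_measure`,
`ProbabilityMeasure.tendsto_measure_of_null_frontier_of_tendsto'`, `ProbabilityTheory.mgf_id_gaussianReal`,
`integrable_exp_mul_gaussianReal`, `nullSingletonClass_gaussianReal`, `gaussianReal_apply_eq_integral`. Mathlib has no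
continuity theorem for mgfs (searched `Curtiss`, `tendsto.*mgf`, `of_tendsto_mgf`).

## References
* J. H. Curtiss, *A note on the theory of moment generating functions*, Ann. Math. Statist. 13 (1942) 430–433,
  Theorem 3. [cite: Curtiss1942, Theorem 3]
* P. Billingsley, *Probability and Measure*, 3rd ed. (1995), §30 (method of moments), as invoked in
  [cite: DKLM2026SixVertexGFF, Part II §3, proof of Theorem 52].
-/

noncomputable section

open MeasureTheory ProbabilityTheory Filter Topology Set Real Finset

namespace Literature.Probability.Moments

/-! ## §1 Two elementary lemmas -/

/-- A sequence converges along a filter as soon as its even- and odd-indexed subsequences do (to the same limit).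
[cite: Curtiss1942, Theorem 3 (lane plumbing for the interleaving argument)] -/
theorem tendsto_interleave {α : Type*} {u : ℕ → α} {l : Filter α}
    (h0 : Tendsto (fun m => u (2 * m)) atTop l) (h1 : Tendsto (fun m => u (2 * m + 1)) atTop l) :
    Tendsto u atTop l := by
  intro s hs
  have e0 := h0 hs
  have e1 := h1 hs
  rw [Filter.mem_map, mem_atTop_sets] at e0 e1
  rw [Filter.mem_map, mem_atTop_sets]
  obtain ⟨M0, hM0⟩ := e0
  obtain ⟨M1, hM1⟩ := e1
  refine ⟨2 * max M0 M1, fun n hn => ?_⟩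
  obtain ⟨m, rfl | rfl⟩ := Nat.even_or_odd' n
  · exact hM0 m (by omega)
  · exact hM1 m (by omega)

/-- **Polynomial moments from two-sided exponential moments**: if `e^{cx}` and `e^{-cx}` are `ν`-integrable for some
`c > 0`, so is every power `x^k` (`|x|^k ≤ K (e^{cx} + e^{-cx})`, `exists_const_pow_approx`).
[cite: Curtiss1942, Theorem 3 (lane plumbing: moments exist under the mgf hypothesis)] -/
theorem integrable_pow_of_integrable_exp_two_sided {ν : Measure ℝ} {c : ℝ} (hc : 0 < c)
    (hpos : Integrable (fun x => exp (c * x)) ν) (hneg : Integrable (fun x => exp (-c * x)) ν) (k : ℕ) :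
    Integrable (fun x : ℝ => x ^ k) ν := by
  obtain ⟨K, -, hK⟩ := exists_const_pow_approx k hc
  have hb : Integrable (fun x : ℝ => K * (exp (c * x) + exp (-(c * x)))) ν :=
    (hpos.add (hneg.congr (Eventually.of_forall fun x => by simp only [neg_mul]))).const_mul K
  refine hb.mono' (by fun_prop) (Eventually.of_forall fun x => ?_)
  rw [Real.norm_eq_abs]
  exact (hK x).1

/-! ## §2 Curtiss' theorem in one variable, with the limit identified -/

/-- **Curtiss' theorem, moment form in one variable, limit identified.** Let `μ_n` (`n ∈ ℕ`) and `ν` be measures on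
`ℝ` and `δ > 0`; suppose that for every `|s| < δ` the functions `e^{sx}` are integrable for all `μ_n` and for `ν`, and
`∫ e^{sx} dμ_n → ∫ e^{sx} dν`. Then `∫ x^k dμ_n → ∫ x^k dν` for every `k : ℕ`. (Apply the multivariate moment theorem
`tendsto_integral_prod_pow_of_tendsto_mgf` on `Fin 1 → ℝ` to the interleaved sequence `μ_0, ν, μ_1, ν, …`, whose mgfs
still converge; its `k`-th moments converge to some `c`, and the odd subsequence shows `c = ∫ x^k dν`.)
[cite: Curtiss1942, Theorem 3] -/
theorem tendsto_integral_pow_of_tendsto_mgf {μ : ℕ → Measure ℝ} {ν : Measure ℝ} {δ : ℝ} (hδ : 0 < δ)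
    (hμ : ∀ s : ℝ, |s| < δ → ∀ n, Integrable (fun x => exp (s * x)) (μ n))
    (hν : ∀ s : ℝ, |s| < δ → Integrable (fun x => exp (s * x)) ν)
    (hmgf : ∀ s : ℝ, |s| < δ →
      Tendsto (fun n => ∫ x, exp (s * x) ∂μ n) atTop (𝓝 (∫ x, exp (s * x) ∂ν)))
    (k : ℕ) : Tendsto (fun n => ∫ x, x ^ k ∂μ n) atTop (𝓝 (∫ x, x ^ k ∂ν)) := by
  -- the interleaved sequence
  set ρ : ℕ → Measure ℝ := fun n => if Even n then μ (n / 2) else ν with hρ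
  have hρ0 : ∀ m, ρ (2 * m) = μ m := fun m => by
    have h2 : 2 * m / 2 = m := by omega
    simp only [hρ, even_two_mul, if_true, h2]
  have hρ1 : ∀ m, ρ (2 * m + 1) = ν := fun m => by
    have hodd : ¬ Even (2 * m + 1) := Nat.not_even_iff_odd.2 (odd_two_mul_add_one m)
    simp only [hρ, hodd, if_false]
  have h2m : Tendsto (fun m : ℕ => 2 * m) atTop atTop := tendsto_atTop_atTop.2 fun b => ⟨b, fun m hm => by omega⟩
  have h2m1 : Tendsto (fun m : ℕ => 2 * m + 1) atTop atTop :=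
    tendsto_atTop_atTop.2 fun b => ⟨b, fun m hm => by omega⟩
  -- transport to `Fin 1 → ℝ`
  have hem : Measurable fun (x : ℝ) (_ : Fin 1) => x := measurable_pi_lambda _ fun _ => measurable_id
  set ρ' : ℕ → Measure (Fin 1 → ℝ) := fun n => (ρ n).map fun (x : ℝ) (_ : Fin 1) => x with hρ'
  have hint : ∀ F : (Fin 1 → ℝ) → ℝ, Continuous F → ∀ n,
      ∫ x, F x ∂ρ' n = ∫ x, F (fun _ : Fin 1 => x) ∂ρ n := fun F hF n =>
    integral_map hem.aemeasurable hF.aestronglyMeasurable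
  have hintg : ∀ F : (Fin 1 → ℝ) → ℝ, Continuous F → ∀ n,
      Integrable F (ρ' n) ↔ Integrable (F ∘ fun (x : ℝ) (_ : Fin 1) => x) (ρ n) := fun F hF n =>
    integrable_map_measure hF.aestronglyMeasurable hem.aemeasurable
  -- the hypotheses of the multivariate theorem
  have hyp : ∀ s : Fin 1 → ℝ, (∀ i, |s i| < δ) →
      (∀ n, Integrable (fun x => exp (∑ i, s i * x i)) (ρ' n)) ∧
        ∃ L : ℝ, Tendsto (fun n => ∫ x, exp (∑ i, s i * x i) ∂ρ' n) atTop (𝓝 L) := by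
    intro s hs
    have hs0 : |s 0| < δ := hs 0
    have hF : Continuous fun x : Fin 1 → ℝ => exp (∑ i, s i * x i) := by fun_prop
    have hcomp : ((fun x : Fin 1 → ℝ => exp (∑ i, s i * x i)) ∘ fun (x : ℝ) (_ : Fin 1) => x)
        = fun x => exp (s 0 * x) := by
      funext x; simp
    refine ⟨fun n => ?_, ⟨∫ x, exp (s 0 * x) ∂ν, ?_⟩⟩
    · rw [hintg _ hF, hcomp]
      obtain ⟨m, rfl | rfl⟩ := Nat.even_or_odd' n
      · rw [hρ0]; exact hμ _ hs0 m
      · rw [hρ1]; exact hν _ hs0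
    · have h2 : ∀ n, ∫ x, exp (∑ i, s i * x i) ∂ρ' n = ∫ x, exp (s 0 * x) ∂ρ n := fun n => by
        rw [hint _ hF]; simp
      simp_rw [h2]
      refine tendsto_interleave ?_ ?_
      · simp_rw [hρ0]; exact hmgf _ hs0
      · simp_rw [hρ1]; exact tendsto_const_nhds
  obtain ⟨c, hc⟩ := tendsto_integral_prod_pow_of_tendsto_mgf 1 ρ' δ hδ hyp (fun _ => k)
  have hF : Continuous fun x : Fin 1 → ℝ => ∏ i, x i ^ ((fun _ => k : Fin 1 → ℕ) i) := by fun_prop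
  have h2 : ∀ n, ∫ x, ∏ i, x i ^ ((fun _ => k : Fin 1 → ℕ) i) ∂ρ' n = ∫ x, x ^ k ∂ρ n := fun n => by
    rw [hint _ hF]; simp
  simp_rw [h2] at hc
  have hA : Tendsto (fun m => ∫ x, x ^ k ∂μ m) atTop (𝓝 c) := by
    have h := hc.comp h2m
    simp only [Function.comp_def, hρ0] at h
    exact h
  have hB : Tendsto (fun _ : ℕ => ∫ x, x ^ k ∂ν) atTop (𝓝 c) := by
    have h := hc.comp h2m1
    simp only [Function.comp_def, hρ1] at h
    exact h
  have hcν : c = ∫ x, x ^ k ∂ν := tendsto_nhds_unique hB tendsto_const_nhds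
  rw [← hcν]
  exact hA

/-! ## §3 ★★★ Curtiss' continuity theorem: weak convergence -/

/-- ★★★ **Curtiss' continuity theorem for moment generating functions** (limit with all exponential moments). Let
`μ_n` and `ν` be probability measures on `ℝ`, `δ > 0`. If `e^{sx}` is `μ_n`-integrable and `∫ e^{sx} dμ_n → ∫ e^{sx} dν`
for every `|s| < δ`, and `ν` has all exponential moments, then `μ_n ⟶ ν` weakly. (Moments converge by
`tendsto_integral_pow_of_tendsto_mgf`; the method of moments `tendsto_of_tendsto_integral_pow` — characteristic
functions and Lévy's theorem — concludes.) [cite: Curtiss1942, Theorem 3] -/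
theorem tendsto_of_tendsto_mgf {μ : ℕ → ProbabilityMeasure ℝ} {ν : ProbabilityMeasure ℝ} {δ : ℝ} (hδ : 0 < δ)
    (hμ : ∀ s : ℝ, |s| < δ → ∀ n, Integrable (fun x => exp (s * x)) (μ n : Measure ℝ))
    (hν : ∀ s : ℝ, Integrable (fun x => exp (s * x)) (ν : Measure ℝ))
    (hmgf : ∀ s : ℝ, |s| < δ →
      Tendsto (fun n => ∫ x, exp (s * x) ∂(μ n : Measure ℝ)) atTop (𝓝 (∫ x, exp (s * x) ∂(ν : Measure ℝ)))) :
    Tendsto μ atTop (𝓝 ν) := by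
  have hc : 0 < δ / 2 := by positivity
  have hcδ : |δ / 2| < δ := by rw [abs_of_pos hc]; linarith
  have hcδ' : |-(δ / 2)| < δ := by rw [abs_neg]; exact hcδ
  have hμk : ∀ n k, Integrable (fun x : ℝ => x ^ k) (μ n : Measure ℝ) := fun n k =>
    integrable_pow_of_integrable_exp_two_sided hc (hμ _ hcδ n) (hμ _ hcδ' n) k
  exact tendsto_of_tendsto_integral_pow hμk hν fun k =>
    tendsto_integral_pow_of_tendsto_mgf hδ hμ (fun s _ => hν s) hmgf k

/-- Curtiss' theorem tested against bounded continuous functions: under the hypotheses of `tendsto_of_tendsto_mgf`,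
`∫ g dμ_n → ∫ g dν` for every bounded continuous `g`. [cite: Curtiss1942, Theorem 3; Durrett2019, §3.2 Theorem 3.2.9 (book p. 123)] -/
theorem tendsto_integral_of_tendsto_mgf {μ : ℕ → ProbabilityMeasure ℝ} {ν : ProbabilityMeasure ℝ} {δ : ℝ}
    (hδ : 0 < δ) (hμ : ∀ s : ℝ, |s| < δ → ∀ n, Integrable (fun x => exp (s * x)) (μ n : Measure ℝ))
    (hν : ∀ s : ℝ, Integrable (fun x => exp (s * x)) (ν : Measure ℝ))
    (hmgf : ∀ s : ℝ, |s| < δ →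
      Tendsto (fun n => ∫ x, exp (s * x) ∂(μ n : Measure ℝ)) atTop (𝓝 (∫ x, exp (s * x) ∂(ν : Measure ℝ))))
    (g : BoundedContinuousFunction ℝ ℝ) :
    Tendsto (fun n => ∫ x, g x ∂(μ n : Measure ℝ)) atTop (𝓝 (∫ x, g x ∂(ν : Measure ℝ))) :=
  (ProbabilityMeasure.tendsto_iff_forall_integral_tendsto.1 (tendsto_of_tendsto_mgf hδ hμ hν hmgf)) g

/-- **Distribution functions converge at every point when the limit has no atoms** (portmanteau): if `μ_n ⟶ ν`
weakly and `ν` has no atoms, then `μ_n(−∞, x] → ν(−∞, x]` for every real `x` (every `x` is a continuity point).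
[cite: Durrett2019, §3.2 Theorem 3.2.11 (iv) (book p. 124); definition of weak convergence of distribution functions §3.2 (p. 121)] -/
theorem tendsto_measure_Iic_of_tendsto {μ : ℕ → ProbabilityMeasure ℝ} {ν : ProbabilityMeasure ℝ}
    [NullSingletonClass (ν : Measure ℝ)] (h : Tendsto μ atTop (𝓝 ν)) (x : ℝ) :
    Tendsto (fun n => (μ n : Measure ℝ) (Iic x)) atTop (𝓝 ((ν : Measure ℝ) (Iic x))) :=
  ProbabilityMeasure.tendsto_measure_of_null_frontier_of_tendsto' h
    (by rw [frontier_Iic]; exact measure_singleton x)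

/-- Real-valued form of `tendsto_measure_Iic_of_tendsto`: `μ_n(−∞, x] → ν(−∞, x]` in `ℝ`.
[cite: Durrett2019, §3.2 Theorem 3.2.11 (iv) (book p. 124)] -/
theorem tendsto_measureReal_Iic_of_tendsto {μ : ℕ → ProbabilityMeasure ℝ} {ν : ProbabilityMeasure ℝ}
    [NullSingletonClass (ν : Measure ℝ)] (h : Tendsto μ atTop (𝓝 ν)) (x : ℝ) :
    Tendsto (fun n => (μ n : Measure ℝ).real (Iic x)) atTop (𝓝 ((ν : Measure ℝ).real (Iic x))) :=
  (ENNReal.tendsto_toReal (measure_ne_top _ _)).comp (tendsto_measure_Iic_of_tendsto h x)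

/-! ## §4 ★★★ The Gaussian case -/

/-- ★★★ **Curtiss' theorem, Gaussian limit.** If `e^{sx}` is `μ_n`-integrable and `∫ e^{sx} dμ_n → e^{ms + vs²/2}` for
every `|s| < δ`, then `μ_n ⟶ N(m, v)` weakly. [cite: Curtiss1942, Theorem 3] -/
theorem tendsto_gaussianReal_of_tendsto_mgf {μ : ℕ → ProbabilityMeasure ℝ} (m : ℝ) (v : NNReal) {δ : ℝ}
    (hδ : 0 < δ) (hμ : ∀ s : ℝ, |s| < δ → ∀ n, Integrable (fun x => exp (s * x)) (μ n : Measure ℝ))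
    (hmgf : ∀ s : ℝ, |s| < δ →
      Tendsto (fun n => ∫ x, exp (s * x) ∂(μ n : Measure ℝ)) atTop (𝓝 (exp (m * s + v * s ^ 2 / 2)))) :
    Tendsto μ atTop (𝓝 ⟨gaussianReal m v, inferInstance⟩) := by
  refine tendsto_of_tendsto_mgf (ν := ⟨gaussianReal m v, inferInstance⟩) hδ hμ
    (fun s => integrable_exp_mul_gaussianReal s) fun s hs => ?_
  -- `∫ e^{sx} dN(m,v) = e^{ms + vs²/2}` is Mathlib's `mgf_id_gaussianReal`
  have hG : ∫ x, exp (s * x) ∂gaussianReal m v = exp (m * s + v * s ^ 2 / 2) := by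
    have h := congrFun (mgf_id_gaussianReal (μ := m) (v := v)) s
    simpa [mgf] using h
  rw [ProbabilityMeasure.coe_mk, hG]
  exact hmgf s hs

/-- ★★★ **Curtiss' theorem, Gaussian limit, distribution functions.** Under the hypotheses of
`tendsto_gaussianReal_of_tendsto_mgf` with `v ≠ 0`: `μ_n(−∞, x] → N(m, v)(−∞, x]` for EVERY real `x` (the Gaussian
has no atoms). [cite: Curtiss1942, Theorem 3] -/
theorem tendsto_measureReal_Iic_gaussianReal_of_tendsto_mgf {μ : ℕ → ProbabilityMeasure ℝ} (m : ℝ) {v : NNReal}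
    (hv : v ≠ 0) {δ : ℝ} (hδ : 0 < δ)
    (hμ : ∀ s : ℝ, |s| < δ → ∀ n, Integrable (fun x => exp (s * x)) (μ n : Measure ℝ))
    (hmgf : ∀ s : ℝ, |s| < δ →
      Tendsto (fun n => ∫ x, exp (s * x) ∂(μ n : Measure ℝ)) atTop (𝓝 (exp (m * s + v * s ^ 2 / 2))))
    (x : ℝ) :
    Tendsto (fun n => (μ n : Measure ℝ).real (Iic x)) atTop (𝓝 ((gaussianReal m v).real (Iic x))) := by
  exact @tendsto_measureReal_Iic_of_tendsto μ ⟨gaussianReal m v, inferInstance⟩ (nullSingletonClass_gaussianReal hv)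
    (tendsto_gaussianReal_of_tendsto_mgf m v hδ hμ hmgf) x

/-- ★★★ The same with the Gaussian distribution function written as the integral of the density:
`μ_n(−∞, x] → ∫_{(−∞, x]} φ_{m,v}(t) dt` for every real `x` (`v ≠ 0`; Mathlib `gaussianReal_apply_eq_integral`).
[cite: Curtiss1942, Theorem 3; Durrett2019, §3.1 (Gaussian density), §3.2 Theorem 3.2.11 (iv) (book p. 124)] -/
theorem tendsto_measureReal_Iic_gaussianReal_of_tendsto_mgf' {μ : ℕ → ProbabilityMeasure ℝ} (m : ℝ) {v : NNReal}
    (hv : v ≠ 0) {δ : ℝ} (hδ : 0 < δ)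
    (hμ : ∀ s : ℝ, |s| < δ → ∀ n, Integrable (fun x => exp (s * x)) (μ n : Measure ℝ))
    (hmgf : ∀ s : ℝ, |s| < δ →
      Tendsto (fun n => ∫ x, exp (s * x) ∂(μ n : Measure ℝ)) atTop (𝓝 (exp (m * s + v * s ^ 2 / 2))))
    (x : ℝ) :
    Tendsto (fun n => (μ n : Measure ℝ).real (Iic x)) atTop (𝓝 (∫ t in Iic x, gaussianPDFReal m v t)) := by
  have hI : (gaussianReal m v).real (Iic x) = ∫ t in Iic x, gaussianPDFReal m v t := by
    rw [measureReal_def, gaussianReal_apply_eq_integral m hv, ENNReal.toReal_ofReal]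
    exact setIntegral_nonneg measurableSet_Iic fun t _ => gaussianPDFReal_nonneg m v t
  rw [← hI]
  exact tendsto_measureReal_Iic_gaussianReal_of_tendsto_mgf m hv hδ hμ hmgf x

end Literature.Probability.Moments

end
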